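import Summits.AtomisticToContinuum.Crystallization.Theorems.FrustratedLawDichotomyStrainedPatchWindowTaylorTail
import Summits.AtomisticToContinuum.Crystallization.Theorems.FrustratedLawDichotomyStrainedPatchTaylorPairSigned
import Summits.AtomisticToContinuum.Crystallization.Theorems.FrustratedLawDichotomyStrainedPatchTaylorKbandKitSigned

/-!
# ★ (T2⁻) PROVED — the second-order inequality of record with the ONE-SIDED band table `KbandMinus` (lens-5 g56; crux 27623 T-side)

Task of record (critic row 1035 / NODE-g55 §5 / census KBAND29 hand-off): replace the two-sided table `Kband` (`|W″|, |W′|/s ≤ K`) in the quadratic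
penalty `quad_{w₀}` of (T2ʷ) by the SIGNED table `K⁻ = KbandMinus` (`(−W″)₊, (−W′/s)₊ ≤ K⁻`: only the ADVERSE part of the pair Hessian is charged — where
`W₄₅` is convex with `W′ ≥ 0` the penalty is `0`).  The constants are EXACTLY the census column `proposed_constant_exact` of
`census/data/kband29/KBANDminus__2delta1over10_delta01over20__tree_partition.csv` (census-1 g29, bands = the tree partition of `Kband`):
`138, 133, 236/5, 86/5, 311/50, 327/500, 327/500, 367/1000, 101/2500, 143/100000, 0` versus `Kband = 2700, 2146, 792, 304, 121, 20, 1, 1/2, 1/20, 1/500, 0`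
(a factor `19.6` at contact, `30` on `[21/20, 6/5)`, `≥ 1.36` everywhere; `KbandMinus ≤ Kband`).
§1 the table; §2 ★ `kbandMinusCert_holds : KbandCertSigned KbandMinus` by the one-sided band kit `…TaylorKbandKitSigned` on 36 sub-bands (the census plan
`PLAN_KBANDminus_tree_partition_2d1over10.csv` has 128 decoupled sub-bands; the monotone variants `bump_band_minus_incr/decr` of the kit — `7s⁻⁸ − 13s⁻¹⁴`
is unimodal with peak at `s⁶ = 13/4` — make 36 suffice; every numerical side condition closed by `norm_num`); §3 ★★★ `taylorTwoBentWMinus_holds :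
SmoothTaylorTwo CompFamilyW tau1 delta0 G0 wMinus rho0` (`wMinus := wOf KbandMinus`) through the general-`K` seam of `…TaylorPairSigned`, and the sanity edge
(T2⁻) ⟹ (T2ʷ); §4 the g54W record with (T2⁻) discharged: binder (LINᴿ-bentW Ψ) becomes `SlavedRBentWMinus Ψ` (same `PairedSlaved`, weight `wMinus`) —
★★★ `coreOff_record_g56W`, nine binders, [CORE-FAR] `CoreOffTubeFloor (63/10) (63/10) (24/5) (1/100) 0`.  The D-side (`ChartFamilyD`, g55 record) is in
`…TaylorKbandMinusD`.  0 sorry.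
-/

open scoped BigOperators Classical
open Summit.AtomisticToContinuum.Crystallization.Theorems.FrustratedLawDichotomyRangeCut (Sep)
open Summit.AtomisticToContinuum.Crystallization.Theorems.FrustratedLawDichotomyMotifLemmas
open Summit.AtomisticToContinuum.Crystallization.Theorems.FrustratedLawDichotomyAveragingCut
open Summit.AtomisticToContinuum.Crystallization.Theorems.FrustratedLawDichotomyAveragingRuleCap
open Summit.AtomisticToContinuum.Crystallization.Theorems.FrustratedLawDichotomyAveragingRuleTightFree
open Summit.AtomisticToContinuum.Crystallization.Theorems.FrustratedLawDichotomyExemptAbsorptionRecord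
open Summit.AtomisticToContinuum.Crystallization.Theorems.FrustratedLawDichotomySchurCut
open Literature.MathematicalPhysics.StatisticalMechanics (lennardJones lennardJones_nonpos)
open Summit.AtomisticToContinuum.Crystallization.Theorems.FrustratedLawDichotomyRuleToolkitGood
open Summit.AtomisticToContinuum.Crystallization.Theorems.FrustratedLawDichotomyStrainedPatchHomSplit
open Summit.AtomisticToContinuum.Crystallization.Theorems.FrustratedLawDichotomyStrainedPatchHomTermCalculus
open Summit.AtomisticToContinuum.Crystallization.Theorems.FrustratedLawDichotomyStrainedPatchChartFamilies
open Summit.AtomisticToContinuum.Crystallization.Theorems.FrustratedLawDichotomyStrainedPatchChartFamiliesBent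
open Summit.AtomisticToContinuum.Crystallization.Theorems.FrustratedLawDichotomyStrainedPatchChartFamiliesPinned
open Summit.AtomisticToContinuum.Crystallization.Theorems.FrustratedLawDichotomyStrainedPatchEnvelopeLaw
open Summit.AtomisticToContinuum.Crystallization.Theorems.FrustratedLawDichotomyStrainedPatchEnvelopeTaylor
open Summit.AtomisticToContinuum.Crystallization.Theorems.FrustratedLawDichotomyStrainedPatchTaylorSplit
open Summit.AtomisticToContinuum.Crystallization.Theorems.FrustratedLawDichotomyStrainedPatchTaylorPair
open Summit.AtomisticToContinuum.Crystallization.Theorems.FrustratedLawDichotomyStrainedPatchTaylorChord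
open Summit.AtomisticToContinuum.Crystallization.Theorems.FrustratedLawDichotomyStrainedPatchTaylorLeaves
open Summit.AtomisticToContinuum.Crystallization.Theorems.FrustratedLawDichotomyStrainedPatchTaylorRegular
open Summit.AtomisticToContinuum.Crystallization.Theorems.FrustratedLawDichotomyStrainedPatchTaylorKbandKit
open Summit.AtomisticToContinuum.Crystallization.Theorems.FrustratedLawDichotomyStrainedPatchTaylorKband
open Summit.AtomisticToContinuum.Crystallization.Theorems.FrustratedLawDichotomyStrainedPatchTaylorTail
open Summit.AtomisticToContinuum.Crystallization.Theorems.FrustratedLawDichotomyStrainedPatchTaylorCap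
open Literature.Barriers.AtomisticToContinuum.FlatleyTheil2015 (fccVec fccPoint norm_fccPoint_sq fccPoint_injective)
open Summit.AtomisticToContinuum.Crystallization.Theorems.FrustratedLawDichotomyStrainedPatchHomLattice (latPt_add latPt_sub latPt_neg)
open Summit.AtomisticToContinuum.Crystallization.Theorems.FrustratedLawDichotomyStrainedPatchHomRelief (latPt_fccVec_eq)
open Summit.AtomisticToContinuum.Crystallization.Theorems.FrustratedLawDichotomyStrainedPatchHomLatticeBox
open Summit.AtomisticToContinuum.Crystallization.Theorems.FrustratedLawDichotomyStrainedPatchHomLatticeBoxHcp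
open Summit.AtomisticToContinuum.Crystallization.Theorems.FrustratedLawDichotomyFarFieldSharp (card_le_of_separated_shell_three)
open Summit.AtomisticToContinuum.Crystallization.Theorems.FrustratedLawDichotomyStrainedPatchTaylorLattice
open Summit.AtomisticToContinuum.Crystallization.Theorems.FrustratedLawDichotomyStrainedPatchTaylorClose
open Summit.AtomisticToContinuum.Crystallization.Theorems.FrustratedLawDichotomyStrainedPatchRecutPairs
open Summit.AtomisticToContinuum.Crystallization.Theorems.FrustratedLawDichotomyStrainedPatchRecutKinematics
open Summit.AtomisticToContinuum.Crystallization.Theorems.FrustratedLawDichotomyStrainedPatchWindowFamilies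
open Summit.AtomisticToContinuum.Crystallization.Theorems.FrustratedLawDichotomyStrainedPatchWindowTaylorSplit
open Summit.AtomisticToContinuum.Crystallization.Theorems.FrustratedLawDichotomyStrainedPatchRecutRecord
open Summit.AtomisticToContinuum.Crystallization.Theorems.FrustratedLawDichotomyStrainedPatchCoreTube
open Summit.AtomisticToContinuum.Crystallization.Theorems.FrustratedLawDichotomyStrainedPatchStrainBands
open Summit.AtomisticToContinuum.Crystallization.Theorems.FrustratedLawDichotomyStrainedPatchWindowTaylorTail
open Summit.AtomisticToContinuum.Crystallization.Theorems.FrustratedLawDichotomyStrainedPatchTaylorChordSigned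
open Summit.AtomisticToContinuum.Crystallization.Theorems.FrustratedLawDichotomyStrainedPatchTaylorPairSigned
open Summit.AtomisticToContinuum.Crystallization.Theorems.FrustratedLawDichotomyStrainedPatchTaylorKbandKitSigned

namespace Summit.AtomisticToContinuum.Crystallization.Theorems.FrustratedLawDichotomyStrainedPatchTaylorKbandMinus

/-! ## §1. The one-sided band table `K⁻` of record -/

/-- ★ **`K⁻ = KbandMinus`** — the census table KBAND29 (`KBANDminus__2delta1over10_delta01over20__tree_partition.csv`, column `proposed_constant_exact`):
on the band of `r` (same partition as `Kband`), `(−W₄₅″(s))₊ ≤ K⁻(r)` and `(−W₄₅′(s)/s)₊ ≤ K⁻(r)` for `s ∈ [chordLo r, r + 1/10]`. -/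
noncomputable def KbandMinus (r : ℝ) : ℝ :=
  if r < 4 / 5 then 138 else if r < 17 / 20 then 133 else if r < 9 / 10 then 236 / 5 else if r < 19 / 20 then 86 / 5 else if r < 21 / 20 then 311 / 50
  else if r < 6 / 5 then 327 / 500 else if r < 3 / 2 then 327 / 500 else if r < 2 then 367 / 1000 else if r < 3 then 101 / 2500 else if r < 47 / 10 then 143 / 100000
  else 0

/-- `K⁻ ≥ 0`. [formal bookkeeping] -/
theorem KbandMinus_nonneg (r : ℝ) : 0 ≤ KbandMinus r := by
  unfold KbandMinus
  split_ifs <;> norm_num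
set_option maxHeartbeats 400000 in
/-- `K⁻ ≤ Kband` pointwise. [formal bookkeeping] -/
theorem KbandMinus_le_Kband (r : ℝ) : KbandMinus r ≤ Kband r := by
  unfold KbandMinus Kband
  split_ifs <;> norm_num

/-! ## §2. ★ The signed certificate `KbandCertSigned KbandMinus` on 36 sub-bands -/

/-- Sub-band `[69821/100000, 143/200]` (bump regime, decoupled), `K = 138`. [formal bookkeeping] -/
theorem sb_k0_1 : BandOKMinus (69821 / 100000) (143 / 200) (138) := bump_band_minus (by norm_num [S1, S2])

/-- Sub-band `[143/200, 9/10]` (bump regime, decoupled), `K = 138`. [formal bookkeeping] -/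
theorem sb_k0_2 : BandOKMinus (143 / 200) (9 / 10) (138) := bump_band_minus (by norm_num [S1, S2])

/-- Band k0: `r ∈ [7/10, 4/5)`, `s ∈ [69821/100000, 9/10]`, `K = 138` (2 sub-bands). [formal bookkeeping] -/
theorem band_k0 : BandOKMinus (69821 / 100000) (9 / 10) (138) :=
  sb_k0_1.union sb_k0_2

/-- Sub-band `[7/10, 143/200]` (bump regime, decoupled), `K = 133`. [formal bookkeeping] -/
theorem sb_k1_1 : BandOKMinus (7 / 10) (143 / 200) (133) := bump_band_minus (by norm_num [S1, S2])

/-- Sub-band `[143/200, 19/20]` (bump regime, decoupled), `K = 133`. [formal bookkeeping] -/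
theorem sb_k1_2 : BandOKMinus (143 / 200) (19 / 20) (133) := bump_band_minus (by norm_num [S1, S2])

/-- Band k1: `r ∈ [4/5, 17/20)`, `s ∈ [7/10, 19/20]`, `K = 133` (2 sub-bands). [formal bookkeeping] -/
theorem band_k1 : BandOKMinus (7 / 10) (19 / 20) (133) :=
  sb_k1_1.union sb_k1_2

/-- Sub-band `[3/4, 19/25]` (bump regime, decoupled), `K = 236/5`. [formal bookkeeping] -/
theorem sb_k2_1 : BandOKMinus (3 / 4) (19 / 25) (236 / 5) := bump_band_minus (by norm_num [S1, S2])

/-- Sub-band `[19/25, 1]` (bump regime, `f` increasing (`hi⁶ ≤ 13/4`)), `K = 236/5`. [formal bookkeeping] -/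
theorem sb_k2_2 : BandOKMinus (19 / 25) (1) (236 / 5) := bump_band_minus_incr (by norm_num [S1, S2])

/-- Band k2: `r ∈ [17/20, 9/10)`, `s ∈ [3/4, 1]`, `K = 236/5` (2 sub-bands). [formal bookkeeping] -/
theorem band_k2 : BandOKMinus (3 / 4) (1) (236 / 5) :=
  sb_k2_1.union sb_k2_2

/-- Sub-band `[4/5, 161/200]` (bump regime, decoupled), `K = 86/5`. [formal bookkeeping] -/
theorem sb_k3_1 : BandOKMinus (4 / 5) (161 / 200) (86 / 5) := bump_band_minus (by norm_num [S1, S2])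

/-- Sub-band `[161/200, 171/200]` (bump regime, decoupled), `K = 86/5`. [formal bookkeeping] -/
theorem sb_k3_2 : BandOKMinus (161 / 200) (171 / 200) (86 / 5) := bump_band_minus (by norm_num [S1, S2])

/-- Sub-band `[171/200, 21/20]` (bump regime, `f` increasing (`hi⁶ ≤ 13/4`)), `K = 86/5`. [formal bookkeeping] -/
theorem sb_k3_3 : BandOKMinus (171 / 200) (21 / 20) (86 / 5) := bump_band_minus_incr (by norm_num [S1, S2])

/-- Band k3: `r ∈ [9/10, 19/20)`, `s ∈ [4/5, 21/20]`, `K = 86/5` (3 sub-bands). [formal bookkeeping] -/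
theorem band_k3 : BandOKMinus (4 / 5) (21 / 20) (86 / 5) :=
  (sb_k3_1.union sb_k3_2).union sb_k3_3

/-- Sub-band `[17/20, 171/200]` (bump regime, decoupled), `K = 311/50`. [formal bookkeeping] -/
theorem sb_k4_1 : BandOKMinus (17 / 20) (171 / 200) (311 / 50) := bump_band_minus (by norm_num [S1, S2])

/-- Sub-band `[171/200, 22/25]` (bump regime, decoupled), `K = 311/50`. [formal bookkeeping] -/
theorem sb_k4_2 : BandOKMinus (171 / 200) (22 / 25) (311 / 50) := bump_band_minus (by norm_num [S1, S2])

/-- Sub-band `[22/25, 23/20]` (bump regime, `f` increasing (`hi⁶ ≤ 13/4`)), `K = 311/50`. [formal bookkeeping] -/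
theorem sb_k4_3 : BandOKMinus (22 / 25) (23 / 20) (311 / 50) := bump_band_minus_incr (by norm_num [S1, S2])

/-- Band k4: `r ∈ [19/20, 21/20)`, `s ∈ [17/20, 23/20]`, `K = 311/50` (3 sub-bands). [formal bookkeeping] -/
theorem band_k4 : BandOKMinus (17 / 20) (23 / 20) (311 / 50) :=
  (sb_k4_1.union sb_k4_2).union sb_k4_3

/-- Sub-band `[19/20, 191/200]` (bump regime, decoupled), `K = 327/500`. [formal bookkeeping] -/
theorem sb_k5_1 : BandOKMinus (19 / 20) (191 / 200) (327 / 500) := bump_band_minus (by norm_num [S1, S2])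

/-- Sub-band `[191/200, 97/100]` (bump regime, decoupled), `K = 327/500`. [formal bookkeeping] -/
theorem sb_k5_2 : BandOKMinus (191 / 200) (97 / 100) (327 / 500) := bump_band_minus (by norm_num [S1, S2])

/-- Sub-band `[97/100, 51/50]` (bump regime, decoupled), `K = 327/500`. [formal bookkeeping] -/
theorem sb_k5_3 : BandOKMinus (97 / 100) (51 / 50) (327 / 500) := bump_band_minus (by norm_num [S1, S2])

/-- Sub-band `[51/50, 237/200]` (bump regime, `f` increasing (`hi⁶ ≤ 13/4`)), `K = 327/500`. [formal bookkeeping] -/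
theorem sb_k5_4 : BandOKMinus (51 / 50) (237 / 200) (327 / 500) := bump_band_minus_incr (by norm_num [S1, S2])

/-- Sub-band `[237/200, 243/200]` (bump regime, `f` increasing (`hi⁶ ≤ 13/4`)), `K = 327/500`. [formal bookkeeping] -/
theorem sb_k5_5 : BandOKMinus (237 / 200) (243 / 200) (327 / 500) := bump_band_minus_incr (by norm_num [S1, S2])

/-- Sub-band `[243/200, 1217/1000]` (bump regime, decoupled), `K = 327/500`. [formal bookkeeping] -/
theorem sb_k5_6 : BandOKMinus (243 / 200) (1217 / 1000) (327 / 500) := bump_band_minus (by norm_num [S1, S2])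

/-- Sub-band `[1217/1000, 1219/1000]` (bump regime, decoupled), `K = 327/500`. [formal bookkeeping] -/
theorem sb_k5_7 : BandOKMinus (1217 / 1000) (1219 / 1000) (327 / 500) := bump_band_minus (by norm_num [S1, S2])

/-- Sub-band `[1219/1000, 13/10]` (bump regime, `f` decreasing (`lo⁶ ≥ 13/4`)), `K = 327/500`. [formal bookkeeping] -/
theorem sb_k5_8 : BandOKMinus (1219 / 1000) (13 / 10) (327 / 500) := bump_band_minus_decr (by norm_num [S1, S2])

/-- Band k5: `r ∈ [21/20, 6/5)`, `s ∈ [19/20, 13/10]`, `K = 327/500` (8 sub-bands). [formal bookkeeping] -/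
theorem band_k5 : BandOKMinus (19 / 20) (13 / 10) (327 / 500) :=
  ((((((sb_k5_1.union sb_k5_2).union sb_k5_3).union sb_k5_4).union sb_k5_5).union sb_k5_6).union sb_k5_7).union sb_k5_8

/-- Sub-band `[11/10, 121/100]` (bump regime, `f` increasing (`hi⁶ ≤ 13/4`)), `K = 327/500`. [formal bookkeeping] -/
theorem sb_k6_1 : BandOKMinus (11 / 10) (121 / 100) (327 / 500) := bump_band_minus_incr (by norm_num [S1, S2])

/-- Sub-band `[121/100, 243/200]` (bump regime, `f` increasing (`hi⁶ ≤ 13/4`)), `K = 327/500`. [formal bookkeeping] -/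
theorem sb_k6_2 : BandOKMinus (121 / 100) (243 / 200) (327 / 500) := bump_band_minus_incr (by norm_num [S1, S2])

/-- Sub-band `[243/200, 1217/1000]` (bump regime, decoupled), `K = 327/500`. [formal bookkeeping] -/
theorem sb_k6_3 : BandOKMinus (243 / 200) (1217 / 1000) (327 / 500) := bump_band_minus (by norm_num [S1, S2])

/-- Sub-band `[1217/1000, 1219/1000]` (bump regime, decoupled), `K = 327/500`. [formal bookkeeping] -/
theorem sb_k6_4 : BandOKMinus (1217 / 1000) (1219 / 1000) (327 / 500) := bump_band_minus (by norm_num [S1, S2])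

/-- Sub-band `[1219/1000, 8/5]` (bump regime, `f` decreasing (`lo⁶ ≥ 13/4`)), `K = 327/500`. [formal bookkeeping] -/
theorem sb_k6_5 : BandOKMinus (1219 / 1000) (8 / 5) (327 / 500) := bump_band_minus_decr (by norm_num [S1, S2])

/-- Band k6: `r ∈ [6/5, 3/2)`, `s ∈ [11/10, 8/5]`, `K = 327/500` (5 sub-bands). [formal bookkeeping] -/
theorem band_k6 : BandOKMinus (11 / 10) (8 / 5) (327 / 500) :=
  (((sb_k6_1.union sb_k6_2).union sb_k6_3).union sb_k6_4).union sb_k6_5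

/-- Sub-band `[7/5, 8/5]` (bump regime, `f` decreasing (`lo⁶ ≥ 13/4`)), `K = 367/1000`. [formal bookkeeping] -/
theorem sb_k7_1 : BandOKMinus (7 / 5) (8 / 5) (367 / 1000) := bump_band_minus_decr (by norm_num [S1, S2])

/-- Sub-band `[8/5, 21/10]` (pure-LJ regime), `K = 367/1000`. [formal bookkeeping] -/
theorem sb_k7_2 : BandOKMinus (8 / 5) (21 / 10) (367 / 1000) := lj_band_minus (by norm_num)

/-- Band k7: `r ∈ [3/2, 2)`, `s ∈ [7/5, 21/10]`, `K = 367/1000` (2 sub-bands). [formal bookkeeping] -/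
theorem band_k7 : BandOKMinus (7 / 5) (21 / 10) (367 / 1000) :=
  sb_k7_1.union sb_k7_2

/-- Sub-band `[19/10, 3]` (pure-LJ regime), `K = 101/2500`. [formal bookkeeping] -/
theorem sb_k8_1 : BandOKMinus (19 / 10) (3) (101 / 2500) := lj_band_minus (by norm_num)

/-- Sub-band `[3, 31/10]` (window regime, lower half), `K = 101/2500`. [formal bookkeeping] -/
theorem sb_k8_2 : BandOKMinus (3) (31 / 10) (101 / 2500) := window_band_minus_lo (by norm_num)

/-- Band k8: `r ∈ [2, 3)`, `s ∈ [19/10, 31/10]`, `K = 101/2500` (2 sub-bands). [formal bookkeeping] -/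
theorem band_k8 : BandOKMinus (19 / 10) (31 / 10) (101 / 2500) :=
  sb_k8_1.union sb_k8_2

/-- Sub-band `[29/10, 3]` (pure-LJ regime), `K = 143/100000`. [formal bookkeeping] -/
theorem sb_k9_1 : BandOKMinus (29 / 10) (3) (143 / 100000) := lj_band_minus (by norm_num)

/-- Sub-band `[3, 309/100]` (window regime, lower half), `K = 143/100000`. [formal bookkeeping] -/
theorem sb_k9_2 : BandOKMinus (3) (309 / 100) (143 / 100000) := window_band_minus_lo (by norm_num)

/-- Sub-band `[309/100, 81/25]` (window regime, lower half), `K = 143/100000`. [formal bookkeeping] -/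
theorem sb_k9_3 : BandOKMinus (309 / 100) (81 / 25) (143 / 100000) := window_band_minus_lo (by norm_num)

/-- Sub-band `[81/25, 717/200]` (window regime, lower half), `K = 143/100000`. [formal bookkeeping] -/
theorem sb_k9_4 : BandOKMinus (81 / 25) (717 / 200) (143 / 100000) := window_band_minus_lo (by norm_num)

/-- Sub-band `[717/200, 15/4]` (window regime, lower half), `K = 143/100000`. [formal bookkeeping] -/
theorem sb_k9_5 : BandOKMinus (717 / 200) (15 / 4) (143 / 100000) := window_band_minus_lo (by norm_num)

/-- Sub-band `[15/4, 9/2]` (window regime, upper half), `K = 143/100000`. [formal bookkeeping] -/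
theorem sb_k9_6 : BandOKMinus (15 / 4) (9 / 2) (143 / 100000) := window_band_minus_hi (by norm_num)

/-- Sub-band `[9/2, 24/5]` (far regime), `K = 143/100000`. [formal bookkeeping] -/
theorem sb_k9_7 : BandOKMinus (9 / 2) (24 / 5) (143 / 100000) := far_band_minus (by norm_num)

/-- Band k9: `r ∈ [3, 47/10)`, `s ∈ [29/10, 24/5]`, `K = 143/100000` (7 sub-bands). [formal bookkeeping] -/
theorem band_k9 : BandOKMinus (29 / 10) (24 / 5) (143 / 100000) :=
  (((((sb_k9_1.union sb_k9_2).union sb_k9_3).union sb_k9_4).union sb_k9_5).union sb_k9_6).union sb_k9_7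

/-- ★★ **(N⁻) `KbandCertSigned KbandMinus` PROVED.** Case split on the band of `r`; each band's `s`-range `[chordLo r, r + 1/10]` lies in the
certified range of `band_k0 … band_k9`; beyond `47/10` the potential vanishes near `s` (`far_band_minus`, `K = 0`). [CERTIFIED NUMERICS] -/
theorem kbandMinusCert_holds : KbandCertSigned KbandMinus := by
  intro r s hr hlo hhi hJ
  have hA : r - 1 / 10 ≤ s := (le_max_left _ _).trans hlo
  have hB : (69821 / 100000 : ℝ) ≤ s := (le_max_right _ _).trans hlo
  unfold KbandMinus
  split_ifs with h1 h2 h3 h4 h5 h6 h7 h8 h9 h10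
  · exact band_k0 s hB (by linarith) hJ
  · exact band_k1 s (by linarith) (by linarith) hJ
  · exact band_k2 s (by linarith) (by linarith) hJ
  · exact band_k3 s (by linarith) (by linarith) hJ
  · exact band_k4 s (by linarith) (by linarith) hJ
  · exact band_k5 s (by linarith) (by linarith) hJ
  · exact band_k6 s (by linarith) (by linarith) hJ
  · exact band_k7 s (by linarith) (by linarith) hJ
  · exact band_k8 s (by linarith) (by linarith) hJ
  · exact band_k9 s (by linarith) (by linarith) hJ
  · exact far_band_minus (lo := 23 / 5) (hi := s) ⟨by norm_num, le_rfl⟩ s (by linarith) le_rfl hJ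

/-- (P2a-core⁻) the pair chord lemma with the one-sided table, unconditionally. [folklore] -/
theorem pairChordMinus_holds : PairChordWith KbandMinus := pairChordWith_of_signedCert KbandMinus_nonneg kbandMinusCert_holds

/-! ## §3. ★★★ (T2⁻) -/

/-- ★ **`w⁻ = wMinus := wOf KbandMinus`** — the quadratic-penalty weight table of record for T2⁻: `K⁻(r_{bb'})/(4·#B(b))` for members `b`, else `0`. -/
noncomputable def wMinus : (M₁ : ℕ) → (Fin M₁ → E3) → Fin M₁ → Fin M₁ → Fin M₁ → ℝ := wOf KbandMinus

/-- `w⁻ ≤ w₀` pointwise. [formal bookkeeping] -/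
theorem wMinus_le_w0 (M₁ : ℕ) (z₁ : Fin M₁ → E3) (c₁ b b' : Fin M₁) : wMinus M₁ z₁ c₁ b b' ≤ w0 M₁ z₁ c₁ b b' := by
  rw [w0_eq_wOf]
  exact wOf_mono KbandMinus_le_Kband M₁ z₁ c₁ b b'

/-- `0 ≤ w⁻`. [formal bookkeeping] -/
theorem wMinus_nonneg (M₁ : ℕ) (z₁ : Fin M₁ → E3) (c₁ b b' : Fin M₁) : 0 ≤ wMinus M₁ z₁ c₁ b b' := wOf_nonneg KbandMinus_nonneg M₁ z₁ c₁ b b'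

/-- ★ **(T2⁻) `TaylorTwoBentWMinus`** `:= SmoothTaylorTwo 𝓘₁ʷ (7/20) (1/20) G₀ w⁻ ϱ₀` — (T2ʷ) with the one-sided penalty table. -/
def TaylorTwoBentWMinus : Prop := SmoothTaylorTwo CompFamilyW tau1 delta0 G0 wMinus rho0

/-- ★★★ **(T2⁻) PROVED**: `SmoothTaylorTwo CompFamilyW tau1 delta0 G0 wMinus rho0` holds outright ((N⁻) §2, (C⁻) `chordC11Signed_holds`, (R) `wrecC1_holds`,
(P1) (P2b) (P3a) the W-frame tree pieces, (P3b) `beyondBallTail_of_instanceRimMass12W instanceRimMassLe_holdsW`). [folklore] -/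
theorem taylorTwoBentWMinus_holds : SmoothTaylorTwo CompFamilyW tau1 delta0 G0 wMinus rho0 :=
  smoothTaylorTwoW_of_signedCert KbandMinus_nonneg kbandMinusCert_holds (beyondBallTail_of_instanceRimMass12W instanceRimMassLe_holdsW)

/-- The same, by name. [formal bookkeeping] -/
theorem taylorTwoBentWMinus_holds' : TaylorTwoBentWMinus := taylorTwoBentWMinus_holds

/-- Sanity edge (T2⁻) ⟹ (T2ʷ): the one-sided statement is the STRONGER one (`w⁻ ≤ w₀`). [formal bookkeeping] -/
theorem taylorTwoBentW_of_minus (h : TaylorTwoBentWMinus) : TaylorTwoBentW := smoothTaylorTwo_mono_w wMinus_le_w0 h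

/-! ## §4. The g54W record with (T2⁻): (LINᴿ-bentW Ψ) in the `w⁻` currency -/

/-- ★ **(LINᴿ-bentW⁻ Ψ)** `:= PairedSlaved 𝔓 𝓘₀ᴿʷ 𝓘₁ʷ 𝓑₀ (1/4) (7/20) (2/5) T₀ (1/20) G₀ w⁻ Ψ` — the slaved-relaxation law of the g54W record with the linear
response charged against the ONE-SIDED penalty `quad_{w⁻}` [MECHANICS · UNDECIDED · INSTRUMENTABLE: census LIN / A1 in the `w⁻` currency]. -/
def SlavedRBentWMinus (Ψ : (M₁ : ℕ) → (Fin M₁ → E3) → Fin M₁ → ℝ → ℝ) : Prop :=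
  PairedSlaved projectedFree ChartFamilyRW CompFamilyW bends0 tau0 tau1 kL0 T0 delta0 G0 wMinus Ψ

/-- ★★ LEVEL-2 NODE (W, T2⁻ discharged): (BASᴿ-bentW) ∧ (MEMᴿ-bentW μ) ∧ (LINᴿ-bentW⁻ Ψ) ⟹ (ENVᴿ-bentW (Ψ + ϱ₀ + μ)). [folklore] -/
theorem envelopeRBentW_of_taylorMinus {Ψ : (M₁ : ℕ) → (Fin M₁ → E3) → Fin M₁ → ℝ → ℝ} {μ : (M₁ : ℕ) → (Fin M₁ → E3) → Fin M₁ → ℝ} (hB : BasinRBentW)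
    (hM : MembershipRBentW μ) (hL : SlavedRBentWMinus Ψ) : EnvelopeRBentW (withColumns Ψ μ) :=
  pairedEnvelopeOn_of_taylor hB taylorTwoBentWMinus_holds hM hL

/-- ★★★ THE g56 W-NODE OF RECORD (g54W with (T2⁻) proved; nine binders, every seam proved): for any tables `Ψ, μ`,
(BASᴿ-bentW) ∧ (MEMᴿ-bentW μ) ∧ (LINᴿ-bentW⁻ Ψ) ∧ (RFᴿ-bentW) ∧ (DOMᴿ-bentW (Ψ+ϱ₀+μ)) ∧ (F2ᴿ-bentW0) ∧ (F3ᴿ-bentW) ∧ [BRIDGE] `BandFarFloor … (3/50) (1/10) 0` ∧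
[SOFT-FAR] `SoftFarFloor … (1/10) 0` ⟹ [CORE-FAR] `CoreOffTubeFloor (63/10) (63/10) (24/5) (1/100) 0`. [folklore] -/
theorem coreOff_record_g56W {Ψ : (M₁ : ℕ) → (Fin M₁ → E3) → Fin M₁ → ℝ → ℝ} {μ : (M₁ : ℕ) → (Fin M₁ → E3) → Fin M₁ → ℝ}
    (hB : BasinRBentW) (hM : MembershipRBentW μ) (hL : SlavedRBentWMinus Ψ) (hRF : RecutBentW)
    (hD : DominationRBentW (withColumns Ψ μ)) (hR : FamilyRoomRBentW0) (hC : FamilyCertRBentW)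
    (hBand : BandFarFloor (63 / 10) (63 / 10) (24 / 5) (1 / 100) (3 / 50) (1 / 10) 0) (hS : SoftFarFloor (63 / 10) (63 / 10) (24 / 5) (1 / 100) (1 / 10) 0) :
    CoreOffTubeFloor (63 / 10) (63 / 10) (24 / 5) (1 / 100) 0 :=
  coreOff_of_familyRecutCap_of_band_of_soft (familyEnvelopeCapRBentW_of_pieces hRF (envelopeRBentW_of_taylorMinus hB hM hL) hD) hR hC hBand hS

/-- ★★ The EDGE band alone (no bridge, no residual): the seven pieces ⟹ `EdgeFarFloor (63/10) (63/10) (24/5) (1/100) (3/50) 0`. [folklore] -/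
theorem edgeFar_record_g56W {Ψ : (M₁ : ℕ) → (Fin M₁ → E3) → Fin M₁ → ℝ → ℝ} {μ : (M₁ : ℕ) → (Fin M₁ → E3) → Fin M₁ → ℝ}
    (hB : BasinRBentW) (hM : MembershipRBentW μ) (hL : SlavedRBentWMinus Ψ) (hRF : RecutBentW)
    (hD : DominationRBentW (withColumns Ψ μ)) (hR : FamilyRoomRBentW0) (hC : FamilyCertRBentW) :
    EdgeFarFloor (63 / 10) (63 / 10) (24 / 5) (1 / 100) (3 / 50) 0 :=
  edgeFar_capRBentW (familyEnvelopeCapRBentW_of_pieces hRF (envelopeRBentW_of_taylorMinus hB hM hL) hD) hR hC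

/-- The generic-`w` form of the g54W record (any weight table `w` with its own (T2) and (LIN) — for the census's choice of currency). [formal bookkeeping] -/
theorem coreOff_record_g54W_gw {w : (M₁ : ℕ) → (Fin M₁ → E3) → Fin M₁ → Fin M₁ → Fin M₁ → ℝ}
    {Ψ : (M₁ : ℕ) → (Fin M₁ → E3) → Fin M₁ → ℝ → ℝ} {μ : (M₁ : ℕ) → (Fin M₁ → E3) → Fin M₁ → ℝ}
    (hB : BasinRBentW) (hT : SmoothTaylorTwo CompFamilyW tau1 delta0 G0 w rho0) (hM : MembershipRBentW μ)
    (hL : PairedSlaved projectedFree ChartFamilyRW CompFamilyW bends0 tau0 tau1 kL0 T0 delta0 G0 w Ψ) (hRF : RecutBentW)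
    (hD : DominationRBentW (withColumns Ψ μ)) (hR : FamilyRoomRBentW0) (hC : FamilyCertRBentW)
    (hBand : BandFarFloor (63 / 10) (63 / 10) (24 / 5) (1 / 100) (3 / 50) (1 / 10) 0) (hS : SoftFarFloor (63 / 10) (63 / 10) (24 / 5) (1 / 100) (1 / 10) 0) :
    CoreOffTubeFloor (63 / 10) (63 / 10) (24 / 5) (1 / 100) 0 :=
  coreOff_of_familyRecutCap_of_band_of_soft (familyEnvelopeCapRBentW_of_pieces hRF (pairedEnvelopeOn_of_taylor hB hT hM hL) hD) hR hC hBand hS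

/-- (LINᴿ) WEAKENS under DECREASE of the weight table (a smaller penalty charged against the linear response). [formal bookkeeping] -/
theorem pairedSlaved_mono_w {P : (M : ℕ) → (Fin M → E3) → Fin M → (M₁ : ℕ) → (Fin M₁ → E3) → Fin M₁ → (Fin M → Fin M₁) → ℝ → Prop}
    {𝓘₀ 𝓘₁ : (M₀ : ℕ) → (Fin M₀ → E3) → Fin M₀ → Prop} {𝓑₀ : Set (E3 → E3)} {τ₀ τ₁ κL δ : ℝ} {T : (M₀ : ℕ) → (Fin M₀ → E3) → Fin M₀ → ℝ}
    {G : (M₁ : ℕ) → (Fin M₁ → E3) → Fin M₁ → Fin M₁ → (E3 →L[ℝ] ℝ)} {w w' : (M₁ : ℕ) → (Fin M₁ → E3) → Fin M₁ → Fin M₁ → Fin M₁ → ℝ}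
    {Ψ : (M₁ : ℕ) → (Fin M₁ → E3) → Fin M₁ → ℝ → ℝ} (h : ∀ M₁ z₁ c₁ b b', w' M₁ z₁ c₁ b b' ≤ w M₁ z₁ c₁ b b')
    (hL : PairedSlaved P 𝓘₀ 𝓘₁ 𝓑₀ τ₀ τ₁ κL T δ G w Ψ) : PairedSlaved P 𝓘₀ 𝓘₁ 𝓑₀ τ₀ τ₁ κL T δ G w' Ψ := by
  intro M z c M₀ z₀ c₀ e₀ M₁ z₁ c₁ e₁ t hz hcl hm ht htT hpc hP hf
  have h1 := hL M z c M₀ z₀ c₀ e₀ M₁ z₁ c₁ e₁ t hz hcl hm ht htT hpc hP hf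
  have h2 := quadTerm_mono h z c z₁ c₁ e₁
  linarith

/-- (LINᴿ-bentW Ψ) ⟹ (LINᴿ-bentW⁻ Ψ): the g56W record asks LESS than g54W at the slaving binder. [formal bookkeeping] -/
theorem slavedRBentWMinus_of_slavedRBentW {Ψ : (M₁ : ℕ) → (Fin M₁ → E3) → Fin M₁ → ℝ → ℝ} (h : SlavedRBentW Ψ) : SlavedRBentWMinus Ψ :=
  pairedSlaved_mono_w wMinus_le_w0 h

/- REMOVED AT LANDING (hand-2 g27): the sanity corollary `coreOff_record_g54W_of_g56W` has the SAME statement as the tree's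
   `…WindowTaylorTail.coreOff_record_g54W_T2` (gate dedup.landed; precedent: TW's `taylorTwoBent1_holds_of_W`, row 1008 (A3)); its one-line proof was
   `coreOff_record_g56W hB hM (slavedRBentWMinus_of_slavedRBentW hL) hRF hD hR hC hBand hS`.
   /-- Sanity: the g54W record MINUS its (T2ʷ) binder is a corollary of the g56W record. [formal bookkeeping] -/
   theorem coreOff_record_g54W_of_g56W {Ψ : (M₁ : ℕ) → (Fin M₁ → E3) → Fin M₁ → ℝ → ℝ} {μ : (M₁ : ℕ) → (Fin M₁ → E3) → Fin M₁ → ℝ}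
       (hB : BasinRBentW) (hM : MembershipRBentW μ) (hL : SlavedRBentW Ψ) (hRF : RecutBentW)
       (hD : DominationRBentW (withColumns Ψ μ)) (hR : FamilyRoomRBentW0) (hC : FamilyCertRBentW)
       (hBand : BandFarFloor (63 / 10) (63 / 10) (24 / 5) (1 / 100) (3 / 50) (1 / 10) 0) (hS : SoftFarFloor (63 / 10) (63 / 10) (24 / 5) (1 / 100) (1 / 10) 0) :
       CoreOffTubeFloor (63 / 10) (63 / 10) (24 / 5) (1 / 100) 0 :=
     coreOff_record_g56W hB hM (slavedRBentWMinus_of_slavedRBentW hL) hRF hD hR hC hBand hS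
-/

end Summit.AtomisticToContinuum.Crystallization.Theorems.FrustratedLawDichotomyStrainedPatchTaylorKbandMinus
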